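import Literature.AlgebraicGeometry.HodgeTheory.ChartConjugationCanonicalOfComparison
import Literature.AlgebraicGeometry.HodgeTheory.RegularFormRealization
import HarnessLib

/-!
# The kernel statement (G-inj) of the conjugation charts from Grothendieck's comparison map

Family `hodge`, layer `Literature/AlgebraicGeometry/HodgeTheory` (theorems and one small definition,
the conjugate coordinates `conjCoords`; no named fact; net debt 0). Lane `lit-hodgefound`, row S3c
of the V-B2′ programme — the sequel of `ChartConjugationCanonicalOfComparison` (S3b), which reduced
the named fact `chartConjugation_canonical` to (G) `grothendieck_comparison_realize_surjective`,
a rigidity binder (Rig) and the KERNEL binder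
(G-inj) `[ξ.realize A] = 0 → [(ξ.conj σ).realize A'] = 0` for algebraic form expressions `ξ` on a
smooth affine `Y` with closed realisations on analytic models `A` of `Y` and `A'` of `Y^σ`.

Here (G-inj) is DERIVED from the two halves of Grothendieck's comparison statement typed against
the concrete comparison map of `RegularFormRealization` (the carrier the Layer-B tribunal asks
for): for coordinates `x : Fin N → Γ(Y, 𝒪)` generating `Γ(Y, 𝒪)` (`φ_x` surjective, so
`Y ≅ V(ker φ_x) ⊆ 𝔸ᴺ`) and an ideal `I ⊆ ker φ_x`,

* `Function.Injective (regularFormRealize A x hI (k + 1))` — the holomorphic image of regular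
  `(k+1)`-forms on `V(I)` is FAITHFUL (for `I = ker φ_x`: Serre's GAGA, `𝒪_Y → 𝒪_{Y^an}` is
  faithfully flat and `Ω^{k+1}_Y` is locally free on the smooth `Y`), and
* `Function.Injective (deRhamComparison A x hI k)` — the injectivity half of Grothendieck's
  Theorem 1′: a closed regular `k`-form whose holomorphic image is exact is algebraically exact,

imply (G-inj) on every model `A'` of `Y^σ`
(`complexDeRhamCohomology_mk_conj_eq_zero_of_deRhamComparison_injective`).

**Proof** (Charles–Schnell §11.2.2: `σ` induces an isomorphism `(11.2.2)` of the algebraic de Rham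
complexes of `Y` and `Y^σ`, so `α = dβ` on `Y` gives `α^σ = dβ^σ` on `Y^σ`). Let
`[ξ.realize A] = 0`. Since `φ_x` is onto, `ξ.realize A` is the holomorphic image `α^an` of a
POLYNOMIAL `k`-form `α` (`exists_polyFormRealize_eq_realize`); `dα^an = d(ξ.realize A) = 0`, so by
faithfulness `α|_{V(I)}` is closed; its class goes to `[ξ.realize A] = 0` under the comparison map,
so by injectivity `α` is exact on `V(I)`: `α - dβ` vanishes on `V(I)` for a polynomial form `β`.
Base change of coefficients along `σ` preserves exactness (`IsExactOn.map`, Motives): `σ_* α` is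
exact on `V(I^σ)`, hence its holomorphic image on `(Y^σ)^an`, read through the CONJUGATE
COORDINATES `x^σ = (π^σ)^* x` (§1: `(π^σ)^* ∘ φ_x = φ_{x^σ} ∘ σ_*`, because conjugation of constants
is `σ`, `appTop_baseChangeHomFst_constSection`), is an exact smooth form
(`regularFormRealize_mem_cexactSmoothForms`). Finally `(ξ^σ).realize A'` IS that image: `ξ` and the
expression of `α` have the same realisation on `A`, so their conjugates have the same realisation
on `A'` (`AlgFormExpr.realize_conj_eq_zero`, `ConjRealizeClosedProofs`), and the conjugate of the
expression of `α` along `x` is the expression of `σ_* α` along `x^σ` (`PolyForm.conj_toAlgFormExpr`).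

**Corollary** (`chartConjugation_canonical_of_deRhamComparison`). `chartConjugation_canonical`
holds as soon as every smooth affine `Y` with an analytic model `A` has, in each degree `k`,
generating coordinates `x` for which the holomorphic image of regular `(k+1)`-forms on
`V(ker φ_x) ≅ Y` is faithful and Grothendieck's comparison map (5) is BIJECTIVE in degree `k`
(Theorem 1′) — together with the rigidity binder (Rig) of S3b: (G) is then
`grothendieck_comparison_realize_surjective_of_deRhamComparison` and (G-inj) is the theorem above.

## References

* A. Grothendieck, *On the de Rham cohomology of algebraic varieties*, Publ. IHÉS 29 (1966),
  p. 96 (4)–(5) and Thm. 1′. [Grothendieck1966]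
* F. Charles, C. Schnell, *Notes on absolute Hodge classes*, in *Hodge Theory*, Math. Notes 49
  (2014), §11.2.2 (11.2.1)–(11.2.3). [CharlesSchnell2014Notes]
* J.-P. Serre, *Géométrie algébrique et géométrie analytique*, Ann. Inst. Fourier 6 (1956), §2
  n°5–6. [SerreGAGA1956]
* R. Hartshorne, *Algebraic Geometry*, GTM 52 (1977), II §3 and II Ex. 2.7. [Hartshorne1977]
-/

noncomputable section

open CategoryTheory AlgebraicGeometry
open scoped Manifold ContDiff
open Literature.NumberTheory.Transcendental Literature.Geometry.Kaehler
open Literature.AlgebraicGeometry.Motives Literature.AlgebraicGeometry.Motives.AffineDeRham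

namespace Literature.AlgebraicGeometry.HodgeTheory

section HodgeTheory

/-! ### §1 Conjugate coordinates -/

section Coordinates

variable {Y : SchemeOver ℂ} {N : ℕ}

/-- The scalar `c · 1 ∈ Γ(Y, 𝒪)` of `SchemeOver.scalarRingHom` is the constant section `constSection Y c`
(two spellings of the structure map on global sections). [cite: Hartshorne1977, II Ex. 2.7] -/
theorem scalarRingHom_top_eq_constSection (Y : SchemeOver ℂ) (c : ℂ) :
    SchemeOver.scalarRingHom Y ⊤ c = constSection Y c := by
  have h : Y.left.presheaf.map (homOfLE (le_top : (⊤ : Y.left.Opens) ≤ ⊤)).op (constSection Y c) =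
      SchemeOver.scalarRingHom Y ⊤ c := rfl
  rw [← h, show homOfLE (le_top : (⊤ : Y.left.Opens) ≤ ⊤) = 𝟙 _ from Subsingleton.elim _ _, op_id,
    CategoryTheory.Functor.map_id]
  rfl

/-- **Conjugate coordinates**: the pull-backs `x^σ_i := (π^σ)^* x_i ∈ Γ(Y^σ, 𝒪)` of coordinates
`x_i ∈ Γ(Y, 𝒪)` along the projection `π^σ : Y^σ → Y` — "`X^σ` is defined by the conjugates of the
`P_i`". [cite: CharlesSchnell2014Notes, §11.2.2 (11.2.1)] -/
def conjCoords (σ : ℂ ≃+* ℂ) (x : Fin N → Γ(Y.left, ⊤)) :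
    Fin N → Γ((conjugateVariety σ Y).left, ⊤) :=
  fun i ↦ (AlgPoints.conjFst σ Y).appTop (x i)

/-- Unfolding of `conjCoords` (`AlgPoints.conjFst σ Y` is `baseChangeHomFst σ.toRingHom Y`, typed on
`Y^σ`). [cite: CharlesSchnell2014Notes, §11.2.2 (11.2.1)] -/
@[simp]
theorem conjCoords_apply (σ : ℂ ≃+* ℂ) (x : Fin N → Γ(Y.left, ⊤)) (i : Fin N) :
    conjCoords σ x i = (AlgPoints.conjFst σ Y).appTop (x i) :=
  rfl

/-- **Pulling back a polynomial in the coordinates conjugates its coefficients**: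
`(π^σ)^* (f(x)) = (σ_* f)(x^σ)`, i.e. `(π^σ)^* ∘ φ_x = φ_{x^σ} ∘ σ_*` — both are ring maps out of
`ℂ[T]` agreeing on the variables and on constants (`(π^σ)^* (c · 1) = σ(c) · 1`,
`appTop_baseChangeHomFst_constSection`). [cite: CharlesSchnell2014Notes, §11.2.2 (11.2.1)–(11.2.2)] -/
theorem appTop_coordPresentation (σ : ℂ ≃+* ℂ) (x : Fin N → Γ(Y.left, ⊤))
    (f : MvPolynomial (Fin N) ℂ) :
    (AlgPoints.conjFst σ Y).appTop (coordPresentation Y x f) =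
      coordPresentation (conjugateVariety σ Y) (conjCoords σ x) (MvPolynomial.map σ.toRingHom f) := by
  suffices h : (AlgPoints.conjFst σ Y).appTop.hom.comp (coordPresentation Y x) =
      (coordPresentation (conjugateVariety σ Y) (conjCoords σ x)).comp
        (MvPolynomial.map σ.toRingHom) from
    DFunLike.congr_fun h f
  refine MvPolynomial.ringHom_ext (fun c ↦ ?_) (fun i ↦ ?_)
  · rw [RingHom.comp_apply, RingHom.comp_apply, coordPresentation_C, MvPolynomial.map_C,
      coordPresentation_C, scalarRingHom_top_eq_constSection, scalarRingHom_top_eq_constSection]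
    exact appTop_baseChangeHomFst_constSection σ Y c
  · rw [RingHom.comp_apply, RingHom.comp_apply, coordPresentation_X, MvPolynomial.map_X,
      coordPresentation_X, conjCoords_apply]

/-- The same identity with the projection spelled `baseChangeHomFst σ Y` (as in `AlgFormExpr.conj`).
[cite: CharlesSchnell2014Notes, §11.2.2 (11.2.1)–(11.2.2)] -/
theorem appTop_baseChangeHomFst_coordPresentation (σ : ℂ ≃+* ℂ) (x : Fin N → Γ(Y.left, ⊤))
    (f : MvPolynomial (Fin N) ℂ) :
    (baseChangeHomFst σ.toRingHom Y).appTop (coordPresentation Y x f) =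
      coordPresentation (conjugateVariety σ Y) (conjCoords σ x) (MvPolynomial.map σ.toRingHom f) :=
  appTop_coordPresentation σ x f

/-- The conjugate of an ideal `I ⊆ ker φ_x` of relations among the coordinates lies in the kernel of
`φ_{x^σ}`: relations are carried to relations (`(π^σ)^* (f(x)) = (σ_* f)(x^σ)`).
[cite: CharlesSchnell2014Notes, §11.2.2 (11.2.1)] -/
theorem map_le_ker_coordPresentation_conjCoords (σ : ℂ ≃+* ℂ) (x : Fin N → Γ(Y.left, ⊤))
    {I : Ideal (MvPolynomial (Fin N) ℂ)} (hI : I ≤ RingHom.ker (coordPresentation Y x)) :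
    I.map (MvPolynomial.map σ.toRingHom) ≤
      RingHom.ker (coordPresentation (conjugateVariety σ Y) (conjCoords σ x)) := by
  rw [Ideal.map_le_iff_le_comap]
  intro f hf
  rw [Ideal.mem_comap, RingHom.mem_ker, ← appTop_coordPresentation, RingHom.mem_ker.1 (hI hf),
    map_zero]

/-- **The conjugate of the expression of a polynomial form is the expression of its conjugate**:
`(α(x))^σ = (σ_* α)(x^σ)` as expressions on `Y^σ` — coefficients `(π^σ)^* φ_x(p!⁻¹ α_t) =
φ_{x^σ}(p!⁻¹ (σ_* α)_t)` (`σ` fixes `p!`) and arguments `(π^σ)^* x_{t i} = x^σ_{t i}`.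
[cite: CharlesSchnell2014Notes, §11.2.2 (11.2.2)] -/
theorem PolyForm.conj_toAlgFormExpr (σ : ℂ ≃+* ℂ) (x : Fin N → Γ(Y.left, ⊤)) {p : ℕ}
    (α : PolyForm ℂ N p) :
    (PolyForm.toAlgFormExpr x α).conj σ =
      PolyForm.toAlgFormExpr (conjCoords σ x) (PolyForm.map N p σ.toRingHom α) := by
  unfold AlgFormExpr.conj PolyForm.toAlgFormExpr
  dsimp only
  simp only [appTop_baseChangeHomFst_coordPresentation, map_mul, MvPolynomial.map_C, map_inv₀,
    map_natCast, PolyForm.map_apply, conjCoords_apply]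
  rfl

end Coordinates

/-! ### §2 (G-inj) from faithfulness and injectivity of the comparison map -/

section Kernel

variable {E : Type} [NormedAddCommGroup E] [NormedSpace ℂ E] [FiniteDimensional ℂ E] {m : ℕ}
  {Y : SchemeOver ℂ} [IsAffine Y.left] [SmoothOfRelativeDimension m Y.hom] {N : ℕ}

/-- **Expressions with one realisation have conjugates with one realisation** (on any model of
`Y^σ`): the difference realises to `0`, hence so does its conjugate
(`AlgFormExpr.realize_conj_eq_zero`). [cite: CharlesSchnell2014Notes, §11.2.2 (11.2.2)] -/
theorem AlgFormExpr.realize_conj_eq_of_realize_eq (σ : ℂ ≃+* ℂ) (A : AnalyticModel E m Y)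
    (A' : AnalyticModel E m (conjugateVariety σ Y)) {k : ℕ} {ξ₁ ξ₂ : AlgFormExpr Y k}
    (h : ξ₁.realize A = ξ₂.realize A) : (ξ₁.conj σ).realize A' = (ξ₂.conj σ).realize A' := by
  have hsub : (ξ₁.sub ξ₂).realize A = 0 := by
    rw [AlgFormExpr.realize_sub, h, sub_self]
  have h0 := AlgFormExpr.realize_conj_eq_zero σ A A' _ hsub
  rwa [AlgFormExpr.realize_conj_sub, sub_eq_zero] at h0

/-- **(G-inj) from the comparison map.** Let `Y` be smooth affine with analytic model `A` (model
space `E`), `A'` an analytic model of `Y^σ`, `x` coordinates generating `Γ(Y, 𝒪)` and `I ⊆ ker φ_x`.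
If the holomorphic image of regular `(k+1)`-forms on `V(I)` is faithful and Grothendieck's
comparison map (5) is injective in degree `k`, then an algebraic `k`-form expression `ξ` whose
(closed) realisation on `A` has zero class has a conjugate `ξ^σ` whose (closed) realisation on `A'`
has zero class: `ξ^an = α^an` for a polynomial form `α`, closed on `V(I)` by faithfulness, exact on
`V(I)` by injectivity, so `σ_* α` is exact on `V(I^σ)` and `(ξ^σ)^an = (σ_* α)^an` is exact.
[cite: Grothendieck1966, Thm. 1'] [cite: CharlesSchnell2014Notes, §11.2.2 (11.2.2)] -/
theorem complexDeRhamCohomology_mk_conj_eq_zero_of_deRhamComparison_injective (σ : ℂ ≃+* ℂ)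
    (A : AnalyticModel E m Y) (A' : AnalyticModel E m (conjugateVariety σ Y))
    (x : Fin N → Γ(Y.left, ⊤)) (hφ : Function.Surjective (coordPresentation Y x))
    {I : Ideal (MvPolynomial (Fin N) ℂ)} (hI : I ≤ RingHom.ker (coordPresentation Y x)) (k : ℕ)
    (hfaith : Function.Injective (regularFormRealize A x hI (k + 1)))
    (hinj : Function.Injective (deRhamComparison A x hI k))
    (ξ : AlgFormExpr Y k) (hξ : ξ.realize A ∈ cclosedSmoothForms E A.carrier k)
    (hξ' : (ξ.conj σ).realize A' ∈ cclosedSmoothForms E A'.carrier k)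
    (h0 : complexDeRhamCohomology.mk E A.carrier k ⟨_, hξ⟩ = 0) :
    complexDeRhamCohomology.mk E A'.carrier k ⟨_, hξ'⟩ = 0 := by
  -- Step 1: a polynomial form `α` with `α^an = ξ^an`
  obtain ⟨α, hα⟩ := exists_polyFormRealize_eq_realize A x hφ ξ
  -- Step 2: `α` is closed on `V(I)` (faithfulness in degree `k + 1`)
  have hdξ : mextDeriv (ξ.realize A) = 0 := ((mem_cclosedSmoothForms_iff _).1 hξ).2
  have hclosed : RegularForm.mk I α ∈ closedForms I k := by
    refine LinearMap.mem_ker.2 (hfaith ?_)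
    rw [map_zero, regularFormRealize_d, regularFormRealize_mk, hα, hdξ]
  -- Step 3: `α` is exact on `V(I)` (injectivity of the comparison map in degree `k`)
  have hzero : DeRhamCohomology.mk I ⟨RegularForm.mk I α, hclosed⟩ = 0 := by
    refine hinj ?_
    rw [map_zero, deRhamComparison_mk, ← h0]
    congr 1
    refine Subtype.ext ?_
    change regularFormRealize A x hI k (RegularForm.mk I α) = ξ.realize A
    rw [regularFormRealize_mk, hα]
  have hexact : IsExactOn I α :=
    (mk_mem_exactForms_iff I α).1 ((DeRhamCohomology.mk_eq_zero_iff I ⟨_, hclosed⟩).1 hzero)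
  -- Step 4: the conjugate form is exact on `V(I^σ)`
  have hexact' : IsExactOn (I.map (MvPolynomial.map σ.toRingHom)) (PolyForm.map N k σ.toRingHom α) :=
    IsExactOn.map I σ.toRingHom hexact
  -- Step 5: its holomorphic image on `(Y^σ)^an`, along the conjugate coordinates, is exact
  have hI' := map_le_ker_coordPresentation_conjCoords σ x hI
  have hex : polyFormRealize A' (conjCoords σ x) k (PolyForm.map N k σ.toRingHom α) ∈
      cexactSmoothForms E A'.carrier k := by
    have h := regularFormRealize_mem_cexactSmoothForms A' (conjCoords σ x) hI' k
      ((mk_mem_exactForms_iff _ _).2 hexact')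
    rwa [regularFormRealize_mk] at h
  -- Step 6: and that image is the realisation of `ξ^σ`
  have hreal : (ξ.conj σ).realize A' =
      polyFormRealize A' (conjCoords σ x) k (PolyForm.map N k σ.toRingHom α) := by
    rw [← realize_toAlgFormExpr, ← PolyForm.conj_toAlgFormExpr]
    exact AlgFormExpr.realize_conj_eq_of_realize_eq σ A A'
      (by rw [realize_toAlgFormExpr, hα])
  rw [← map_zero (complexDeRhamCohomology.mk E A'.carrier k), complexDeRhamCohomology.mk_eq_mk_iff,
    Submodule.coe_zero, sub_zero]
  change (ξ.conj σ).realize A' ∈ cexactSmoothForms E A'.carrier k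
  rw [hreal]
  exact hex

end Kernel

/-! ### §3 `chartConjugation_canonical` from Grothendieck's comparison map and rigidity -/

/-- **`chartConjugation_canonical` from the comparison map.** Suppose that for every smooth affine
`Y` over `ℂ`, every analytic model `A` of `Y` and every degree `k` there are coordinates
`x₁, …, x_N ∈ Γ(Y, 𝒪)` generating `Γ(Y, 𝒪)` (so `Y ≅ V(ker φ_x) ⊆ 𝔸ᴺ`) such that the holomorphic
image of regular `(k+1)`-forms on `V(ker φ_x)` is faithful and Grothendieck's comparison map (5)
`H^k(Γ(Y, Ω•)) → H^k_dR(Y^an; ℂ)` is BIJECTIVE (Grothendieck 1966, Thm. 1′), and suppose the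
rigidity binder (Rig) of `chartConjugation_canonical_of_comparison`. Then conjugation of
cohomology is canonical: (G) is `grothendieck_comparison_realize_surjective_of_deRhamComparison`,
(G-inj) is `complexDeRhamCohomology_mk_conj_eq_zero_of_deRhamComparison_injective`, and S3b
assembles. [cite: Grothendieck1966, Thm. 1'] [cite: CharlesSchnell2014Notes, §11.2.2 (11.2.2)–(11.2.3)] -/
theorem chartConjugation_canonical_of_deRhamComparison
    (hcmp : ∀ (m : ℕ) (Y : SchemeOver ℂ) [_root_.AlgebraicGeometry.IsAffine Y.left]
      [_root_.AlgebraicGeometry.SmoothOfRelativeDimension m Y.hom]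
      (E : Type) [NormedAddCommGroup E] [NormedSpace ℂ E] [FiniteDimensional ℂ E]
      (A : AnalyticModel E m Y) (k : ℕ),
      ∃ (N : ℕ) (x : Fin N → Γ(Y.left, ⊤)), Function.Surjective (coordPresentation Y x) ∧
        Function.Injective (regularFormRealize A x
          (le_refl (RingHom.ker (coordPresentation Y x))) (k + 1)) ∧
        Function.Bijective (deRhamComparison A x
          (le_refl (RingHom.ker (coordPresentation Y x))) k))
    (hRig : ∀ (k : ℕ) (E : Type) [NormedAddCommGroup E] [NormedSpace ℂ E] [FiniteDimensional ℂ E]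
      (e : ComplexDeRhamIsoFamily E), e.IsNatural → IsRationalDeRhamFamily e k →
      ∃ q : ℚ, ∀ (M : Type) [TopologicalSpace M] [ChartedSpace E M] [IsManifold 𝓘(ℝ, E) ∞ M]
        [T2Space M] [SigmaCompactSpace M] (x : complexDeRhamCohomology E M k),
        e M k x = (q : ℂ) • (integrationDeRhamIsoFamily E).complexify M k x) :
    chartConjugation_canonical := by
  refine chartConjugation_canonical_of_comparison
    (grothendieck_comparison_realize_surjective_of_deRhamComparison fun m Y _ _ E _ _ _ A k ↦ ?_)
    (fun σ m Y _ _ E _ _ _ A A' k ξ hξ hξ' h0 ↦ ?_) hRig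
  · obtain ⟨N, x, -, -, hbij⟩ := hcmp m Y E A k
    exact ⟨N, x, _, le_rfl, hbij.2⟩
  · obtain ⟨N, x, hφ, hfaith, hbij⟩ := hcmp m Y E A k
    exact complexDeRhamCohomology_mk_conj_eq_zero_of_deRhamComparison_injective σ A A' x hφ le_rfl k
      hfaith hbij.1 ξ hξ hξ' h0

end HodgeTheory

end Literature.AlgebraicGeometry.HodgeTheory

end
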